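import Mathlib
import Summits.NavierStokesRegularity.NavierStokesRegularity.Theorems.SubOnsagerCeilingKPSideBranchClassDynamics
import Summits.NavierStokesRegularity.NavierStokesRegularity.Theorems.SubOnsagerCeilingKPFluxBudget
import HarnessLib

/-!
# ENERGY STARVATION by dead-end leak pockets (diagonal feed exits of arbitrary size) — mechanism file
# (helper file for the crux `SubOnsagerCeiling.ForwardTailCeilingKP`, stmt-NavierStokesRegularity-27057, `--supports`; part 1 of 2)

THE LEAK-SPRAY CLASS (def-free, by coefficient hypotheses on a KP network proper `α ∈ E₂(R)`: symmetric, cancelling,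
orthant, diagonal feeds): the chain mode `0` feeds EVERY component one shell up through its own square,
`x²_{0,k} → x_{i,k+1}` with weights `W i ≥ 0` (`W 0 > 0` is the Katz–Pavlović chain itself, `W e`, `e ≠ 0`, are the
LEAK POCKETS), nothing else is coupled (`α a a i (0,0,1) = 0` for `a ≠ 0`, no in-shell triads): the components
`e ≠ 0` are dead ends fed diagonally from the chain at every shell («weak diagonal exits / leak pockets» of the
critics' W5 instrument run — numerics only so far; the LEAD's fan rung concerns the rank-one fan in which every
component re-feeds, a different architecture).  Companion of `Theorems/SubOnsagerCeilingKPDeadEndPumpStarvation.lean`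
(in-shell dead-end pumps); the mechanism is the same ENERGY STARVATION:

* `leakSpray_quadTerm_chain / _leak`, `leakSpray_gateFlux` — closed forms from the normal form `kpProper_quadTerm`;
* `leakSpray_pocket_ge` — `x_{e,N} ≥ (W e/W 0)·x_{0,N}` on `[0,s]` for every shell `N ≥ 1` and every `e ≠ 0` (both are
  driven by `Λ_{N-1}x²_{0,N-1}`, with weights `W e`, `W 0`; the chain mode is drained in addition; same dissipation);
* `leakSpray_outflux_le_influx` — single-mode energy balance of `x_{0,n}`, `n ≥ 1`: total out-flux (chain + leaks)
  `≤` chain in-flux;  `leakSpray_flux_step` — hence `(1 + r)·Φ_{n+1} ≤ Φ_n` for the CHAIN fluxes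
  `Φ_{k+1}(t) = ∫₀ᵗ Λ_k W₀ x²_{0,k} x_{0,k+1}`, `r = (W 1² + W 2² + W 3²)/W 0²`;  `leakSpray_flux_le` — `Φ_{m+1} ≤ E₀ q^m`,
  `q = (1+r)⁻¹`.

The sequel `Theorems/SubOnsagerCeilingKPLeakSprayBarrier.lean` turns this into `ShellBarrierAt R ε₀ α` with
`(1+ε₀)^{2θ} = 1 + r`, `D = (1+r)²` — `θ > 1/2` iff `W 1² + W 2² + W 3² > ε₀·W 0²`, at EVERY scale ratio.
HONEST FRAMING: statements about Tao-type MODEL lattice ODEs (route SubOnsagerCeiling, rung TL-M2Break); one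
architecture class; no stub, crux or summit is proved and nothing here bears on Navier–Stokes regularity.
[cite: Tao2016AveragedNS, §4 (4.2)–(4.3), (4.8), (4.13)] [cite: Teschl2012, §2.4 (Grönwall)]
-/

noncomputable section

-- the sub-problem namespace `NavierStokesRegularity.NavierStokesRegularity` is the tree's layout (D-0017)
set_option linter.dupNamespace false

namespace Summit.NavierStokesRegularity.NavierStokesRegularity.Theorems

open Set Finset MeasureTheory intervalIntegral
open scoped Topology
open Literature.Analysis.FluidPDE.TaoCascade

section LeakSpray

variable {α : Fin 4 → Fin 4 → Fin 4 → ℤ × ℤ × ℤ → ℝ} {W : Fin 4 → ℝ}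

/-- The feeds out of the chain mode: `Σ_a α a a i (0,0,1)·y_a² = W i · y_0²`. [this file] -/
theorem leakSpray_feedSum (hW : ∀ a i : Fin 4, α a a i (0, 0, 1) = if a = 0 then W i else 0)
    (y : Fin 4 → ℝ) (i : Fin 4) : ∑ a, α a a i (0, 0, 1) * y a ^ 2 = W i * y 0 ^ 2 := by
  simp only [hW, Fin.sum_univ_four]
  simp

/-- The drains of component `i`: `Σ_j α i i j (0,0,1)·z_j = [i = 0]·Σ_j W j z_j`. [this file] -/
theorem leakSpray_drainSum (hW : ∀ a i : Fin 4, α a a i (0, 0, 1) = if a = 0 then W i else 0)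
    (z : Fin 4 → ℝ) (i : Fin 4) : ∑ j, α i i j (0, 0, 1) * z j = if i = 0 then ∑ j, W j * z j else 0 := by
  by_cases hi : i = 0
  · subst hi
    simp [hW]
  · simp [hW, hi]

/-- The gate flux through the bond `m → m+1`: `Λ_m · x²_{0,m} · Σ_j W j X_{j,m+1}` (chain + leaks). [this file] -/
theorem leakSpray_gateFlux (hW : ∀ a i : Fin 4, α a a i (0, 0, 1) = if a = 0 then W i else 0)
    (ε₀ : ℝ) (X : Fin 4 → ℤ → ℝ → ℝ) (m : ℕ) (τ : ℝ) :
    (1 + ε₀) ^ ((5 : ℝ) * (m : ℝ) / 2) * ∑ i, ∑ j, α i i j (0, 0, 1) * X i (m : ℤ) τ ^ 2 * X j ((m : ℤ) + 1) τ =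
      (1 + ε₀) ^ ((5 : ℝ) * (m : ℝ) / 2) * (X 0 (m : ℤ) τ ^ 2 * ∑ j, W j * X j ((m : ℤ) + 1) τ) := by
  congr 1
  simp only [hW, Fin.sum_univ_four]
  simp
  ring

variable (hs : IsSymmetricCoeff α) (hc : IsCancellingCoeff α)
  (hO : ∀ (Y : Fin 4 → ℤ → ℝ → ℝ) (τ : ℝ), (∀ (j : Fin 4) (k : ℤ), 1 ≤ k → 0 ≤ Y j k τ) →
    ∀ δ : ℝ, 0 < δ → ∀ (i : Fin 4) (n : ℤ), 1 ≤ n → Y i n τ = 0 → 0 ≤ quadTerm δ α Y i n τ)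
  (hD : ∀ a b i : Fin 4, a ≠ b → α a b i (0, 0, 1) = 0)
  (hW : ∀ a i : Fin 4, α a a i (0, 0, 1) = if a = 0 then W i else 0)
  (hIn : ∀ a b i : Fin 4, α a b i (0, 0, 0) = 0)
include hs hc hO hD hW hIn

/-- **Chain component**: `quadTerm₀(n) = W₀Λ_{n-1}x²_{0,n-1} − Λₙ x_{0,n} Σ_j W j X_{j,n+1}`. [this file] -/
theorem leakSpray_quadTerm_chain (ε₀ : ℝ) (X : Fin 4 → ℤ → ℝ → ℝ) (n : ℤ) (t : ℝ) :
    quadTerm ε₀ α X 0 n t =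
      W 0 * (1 + ε₀) ^ ((5 : ℝ) * ((n : ℝ) - 1) / 2) * X 0 (n - 1) t ^ 2 -
        (1 + ε₀) ^ ((5 : ℝ) * n / 2) * (X 0 n t * ∑ j, W j * X j (n + 1) t) := by
  rw [kpProper_quadTerm hs hc hO hD, leakSpray_feedSum hW (fun a => X a (n - 1) t) 0,
    leakSpray_drainSum hW (fun j => X j (n + 1) t) 0]
  simp [hIn]
  ring

/-- **Leak pocket** `e ≠ 0`: `quadTerm_e(n) = W e·Λ_{n-1}x²_{0,n-1}` (fed by the chain, feeds nothing). [this file] -/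
theorem leakSpray_quadTerm_leak (ε₀ : ℝ) (X : Fin 4 → ℤ → ℝ → ℝ) {e : Fin 4} (he : e ≠ 0) (n : ℤ) (t : ℝ) :
    quadTerm ε₀ α X e n t = W e * (1 + ε₀) ^ ((5 : ℝ) * ((n : ℝ) - 1) / 2) * X 0 (n - 1) t ^ 2 := by
  rw [kpProper_quadTerm hs hc hO hD, leakSpray_feedSum hW (fun a => X a (n - 1) t) e,
    leakSpray_drainSum hW (fun j => X j (n + 1) t) e]
  simp [hIn, he]
  ring

/-- **The leak pockets dominate the chain amplitude at the same shell**: along an honest non-negative `ν`-viscous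
solution from a one-shell datum (`W ≥ 0`, `W 0 > 0`), for every shell `N ≥ 1`, every `e ≠ 0` and `t ∈ [0,s]`:
`(W e/W 0)·x_{0,N}(t) ≤ x_{e,N}(t)` (`u = x_{e,N} − (W e/W 0)x_{0,N}` has `u(0) = 0`, `u' + ν(1+ε₀)^{2N}u ≥ 0`).
[cite: Teschl2012, §2.4 (Grönwall)] -/
theorem leakSpray_pocket_ge {ε₀ ν s : ℝ} (hε : 0 ≤ ε₀) (hW0 : 0 < W 0) (hWnn : ∀ i, 0 ≤ W i)
    {X₀ : Fin 4 → ℝ} {X : Fin 4 → ℤ → ℝ → ℝ}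
    (hdat : ∀ (i : Fin 4) (k : ℤ), X i k 0 = if k = 0 then X₀ i else 0)
    (hode : ∀ (i : Fin 4) (k : ℤ), ∀ t ∈ Icc (0 : ℝ) s, HasDerivWithinAt (X i k)
      (quadTerm ε₀ α X i k t - ν * (1 + ε₀) ^ ((2 : ℝ) * k) * X i k t) (Icc (0 : ℝ) s) t)
    (hnn : ∀ t ∈ Icc (0 : ℝ) s, ∀ (i : Fin 4) (k : ℤ), 1 ≤ k → 0 ≤ X i k t)
    {e : Fin 4} (he : e ≠ 0) {N : ℤ} (hN : 1 ≤ N) :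
    ∀ t ∈ Icc (0 : ℝ) s, W e / W 0 * X 0 N t ≤ X e N t := by
  set κ : ℝ := ν * (1 + ε₀) ^ ((2 : ℝ) * N) with hκ
  -- `u = x_{e,N} − (W e/W 0) x_{0,N}`, `G = e^{κ t} u`
  set u : ℝ → ℝ := fun τ => X e N τ - W e / W 0 * X 0 N τ with hu
  set u' : ℝ → ℝ := fun τ =>
    (W e * (1 + ε₀) ^ ((5 : ℝ) * ((N : ℝ) - 1) / 2) * X 0 (N - 1) τ ^ 2 - κ * X e N τ) -
      W e / W 0 * (W 0 * (1 + ε₀) ^ ((5 : ℝ) * ((N : ℝ) - 1) / 2) * X 0 (N - 1) τ ^ 2 -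
        (1 + ε₀) ^ ((5 : ℝ) * N / 2) * (X 0 N τ * ∑ j, W j * X j (N + 1) τ) - κ * X 0 N τ) with hu'
  have hud : ∀ τ ∈ Icc (0 : ℝ) s, HasDerivWithinAt u (u' τ) (Icc 0 s) τ := by
    intro τ hτ
    have h1 := hode e N τ hτ
    rw [leakSpray_quadTerm_leak hs hc hO hD hW hIn ε₀ X he] at h1
    have h0 := hode 0 N τ hτ
    rw [leakSpray_quadTerm_chain hs hc hO hD hW hIn] at h0
    exact h1.sub (h0.const_mul (W e / W 0))
  -- the key sign: `u' + κ u ≥ 0`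
  have hkey : ∀ τ ∈ Icc (0 : ℝ) s, 0 ≤ u' τ + κ * u τ := by
    intro τ hτ
    have hx : 0 ≤ X 0 N τ := hnn τ hτ 0 _ hN
    have hsum : 0 ≤ ∑ j, W j * X j (N + 1) τ :=
      Finset.sum_nonneg fun j _ => mul_nonneg (hWnn j) (hnn τ hτ j _ (by omega))
    have hsimp : u' τ + κ * u τ =
        W e / W 0 * ((1 + ε₀) ^ ((5 : ℝ) * N / 2) * (X 0 N τ * ∑ j, W j * X j (N + 1) τ)) := by
      simp only [hu, hu']
      field_simp
      ring
    rw [hsimp]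
    have hWe : 0 ≤ W e / W 0 := div_nonneg (hWnn e) hW0.le
    have hΛ : 0 ≤ (1 + ε₀) ^ ((5 : ℝ) * N / 2) := Real.rpow_nonneg (by linarith) _
    exact mul_nonneg hWe (mul_nonneg hΛ (mul_nonneg hx hsum))
  -- `G = e^{κ t} u` is monotone on `[0,s]`
  set G : ℝ → ℝ := fun τ => Real.exp (κ * τ) * u τ with hG
  set G' : ℝ → ℝ := fun τ => Real.exp (κ * τ) * (u' τ + κ * u τ) with hG'
  have hGd : ∀ τ ∈ Icc (0 : ℝ) s, HasDerivWithinAt G (G' τ) (Icc 0 s) τ := by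
    intro τ hτ
    have hexp : HasDerivWithinAt (fun θ => Real.exp (κ * θ)) (Real.exp (κ * τ) * κ) (Icc 0 s) τ := by
      have := ((hasDerivAt_id τ).const_mul κ).exp
      simpa using this.hasDerivWithinAt
    have h := hexp.mul (hud τ hτ)
    refine h.congr_deriv ?_
    simp only [hG']
    ring
  have hGmono : MonotoneOn G (Icc 0 s) := by
    have hGcont : ContinuousOn G (Icc 0 s) := fun τ hτ => (hGd τ hτ).continuousWithinAt
    refine monotoneOn_of_hasDerivWithinAt_nonneg (f' := G') (convex_Icc 0 s) hGcont ?_ ?_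
    · intro x hx
      rw [interior_Icc] at hx ⊢
      exact (hGd x (Ioo_subset_Icc_self hx)).mono Ioo_subset_Icc_self
    · intro x hx
      rw [interior_Icc] at hx
      exact mul_nonneg (Real.exp_pos _).le (hkey x (Ioo_subset_Icc_self hx))
  have hG0 : G 0 = 0 := by
    have h1 : X e N 0 = 0 := by rw [hdat]; simp; omega
    have h2 : X 0 N 0 = 0 := by rw [hdat]; simp; omega
    simp [hG, hu, h1, h2]
  intro t ht
  have hGt : 0 ≤ G t := by
    rw [← hG0]
    exact hGmono ⟨le_rfl, ht.1.trans ht.2⟩ ht ht.1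
  have hexp : 0 < Real.exp (κ * t) := Real.exp_pos _
  have hut : 0 ≤ u t := by
    by_contra hh
    push Not at hh
    have : G t < 0 := by simp only [hG]; nlinarith [mul_pos hexp (neg_pos.2 hh)]
    linarith
  simp only [hu] at hut
  linarith

/-- **Single-mode energy balance of the chain mode** at a shell `m+1 ≥ 1`: the total out-flux (chain + leaks) up to
time `t` is at most the chain in-flux, `∫₀ᵗ Λ_{m+1} x²_{0,m+1} Σ_j W j X_{j,m+2} ≤ ∫₀ᵗ Λ_m W₀ x²_{0,m} x_{0,m+1}`
(`ν ≥ 0`; stored energy and dissipation are `≥ 0`). [cite: Tao2016AveragedNS, §4 (4.8)–(4.9), (4.13)] -/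
theorem leakSpray_outflux_le_influx {ε₀ ν s : ℝ} (hε : 0 ≤ ε₀) (hν : 0 ≤ ν)
    {X₀ : Fin 4 → ℝ} {X : Fin 4 → ℤ → ℝ → ℝ}
    (hdat : ∀ (i : Fin 4) (k : ℤ), X i k 0 = if k = 0 then X₀ i else 0)
    (hXc : ∀ (i : Fin 4) (k : ℤ), Continuous (X i k))
    (hode : ∀ (i : Fin 4) (k : ℤ), ∀ t ∈ Icc (0 : ℝ) s, HasDerivWithinAt (X i k)
      (quadTerm ε₀ α X i k t - ν * (1 + ε₀) ^ ((2 : ℝ) * k) * X i k t) (Icc (0 : ℝ) s) t) (m : ℕ) :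
    ∀ t ∈ Icc (0 : ℝ) s,
      ∫ τ in (0 : ℝ)..t, (1 + ε₀) ^ ((5 : ℝ) * ((m : ℝ) + 1) / 2) *
          (X 0 ((m : ℤ) + 1) τ ^ 2 * ∑ j, W j * X j ((m : ℤ) + 2) τ) ≤
        ∫ τ in (0 : ℝ)..t, (1 + ε₀) ^ ((5 : ℝ) * (m : ℝ) / 2) * (W 0 * X 0 (m : ℤ) τ ^ 2 * X 0 ((m : ℤ) + 1) τ) := by
  have hb : (0 : ℝ) < 1 + ε₀ := by linarith
  set Λm : ℝ := (1 + ε₀) ^ ((5 : ℝ) * (m : ℝ) / 2) with hΛm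
  set Λn : ℝ := (1 + ε₀) ^ ((5 : ℝ) * ((m : ℝ) + 1) / 2) with hΛn
  set κ : ℝ := ν * (1 + ε₀) ^ ((2 : ℝ) * ((m : ℝ) + 1)) with hκ
  have hκ0 : 0 ≤ κ := by positivity
  set x : ℝ → ℝ := fun τ => X 0 ((m : ℤ) + 1) τ with hx
  set xm : ℝ → ℝ := fun τ => X 0 (m : ℤ) τ with hxm
  set D : ℝ → ℝ := fun τ => ∑ j, W j * X j ((m : ℤ) + 2) τ with hDsum
  have hxc : Continuous x := hXc 0 _
  have hxmc : Continuous xm := hXc 0 _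
  have hDc : Continuous D := continuous_finsetSum _ fun j _ => continuous_const.mul (hXc j _)
  -- the equation of the chain mode at shell `m+1`
  have hxd : ∀ τ ∈ Icc (0 : ℝ) s, HasDerivWithinAt x
      (W 0 * Λm * xm τ ^ 2 - Λn * (x τ * D τ) - κ * x τ) (Icc 0 s) τ := by
    intro τ hτ
    have h0 := hode 0 ((m : ℤ) + 1) τ hτ
    rw [leakSpray_quadTerm_chain hs hc hO hD hW hIn] at h0
    have hidx : ((m : ℤ) + 1 - 1) = (m : ℤ) := by omega
    have hidx2 : ((m : ℤ) + 1 + 1) = (m : ℤ) + 2 := by ring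
    have he1 : ((5 : ℝ) * ((((m : ℤ) + 1 : ℤ) : ℝ) - 1) / 2) = (5 : ℝ) * (m : ℝ) / 2 := by push_cast; ring
    have he2 : ((5 : ℝ) * (((m : ℤ) + 1 : ℤ) : ℝ) / 2) = (5 : ℝ) * ((m : ℝ) + 1) / 2 := by push_cast; ring
    have he3 : ((2 : ℝ) * (((m : ℤ) + 1 : ℤ) : ℝ)) = (2 : ℝ) * ((m : ℝ) + 1) := by push_cast; ring
    rw [hidx, hidx2, he1, he2, he3] at h0
    refine h0.congr_deriv ?_
    simp only [hΛm, hΛn, hκ, hx, hxm, hDsum]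
  set IN : ℝ → ℝ := fun τ => Λm * (W 0 * xm τ ^ 2 * x τ) with hIN
  set OUT : ℝ → ℝ := fun τ => Λn * (x τ ^ 2 * D τ) with hOUT
  set VISC : ℝ → ℝ := fun τ => κ * x τ ^ 2 with hVISC
  have hINc : Continuous IN := continuous_const.mul ((continuous_const.mul (hxmc.pow 2)).mul hxc)
  have hOUTc : Continuous OUT := continuous_const.mul ((hxc.pow 2).mul hDc)
  have hVISCc : Continuous VISC := continuous_const.mul (hxc.pow 2)
  set G : ℝ → ℝ := fun τ => (1 / 2 : ℝ) * x τ ^ 2 - (∫ u in (0 : ℝ)..τ, IN u) + (∫ u in (0 : ℝ)..τ, OUT u) +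
    ∫ u in (0 : ℝ)..τ, VISC u with hG
  have hprim : ∀ {f : ℝ → ℝ}, Continuous f → ∀ τ : ℝ,
      HasDerivWithinAt (fun u => ∫ v in (0 : ℝ)..u, f v) (f τ) (Icc 0 s) τ := by
    intro f hf τ
    exact (intervalIntegral.integral_hasDerivAt_right (hf.intervalIntegrable _ _)
      (hf.stronglyMeasurableAtFilter _ _) hf.continuousAt).hasDerivWithinAt
  have hGd : ∀ τ ∈ Icc (0 : ℝ) s, HasDerivWithinAt G 0 (Icc 0 s) τ := by
    intro τ hτ
    have he : HasDerivWithinAt (fun u => (1 / 2 : ℝ) * x u ^ 2)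
        ((1 / 2 : ℝ) * (((2 : ℕ) : ℝ) * x τ ^ (2 - 1) *
          (W 0 * Λm * xm τ ^ 2 - Λn * (x τ * D τ) - κ * x τ))) (Icc 0 s) τ :=
      ((hxd τ hτ).pow 2).const_mul (1 / 2)
    have h := ((he.sub (hprim hINc τ)).add (hprim hOUTc τ)).add (hprim hVISCc τ)
    refine h.congr_deriv ?_
    simp only [hIN, hOUT, hVISC]
    push_cast
    ring
  have hGc : ContinuousOn G (Icc 0 s) := fun τ hτ => (hGd τ hτ).continuousWithinAt
  have hGd' : ∀ u ∈ Ico (0 : ℝ) s, HasDerivWithinAt G 0 (Ici u) u := fun u hu =>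
    (hGd u (Ico_subset_Icc_self hu)).mono_of_mem_nhdsWithin
      (Filter.mem_of_superset (Icc_mem_nhdsGE hu.2) (Icc_subset_Icc hu.1 le_rfl))
  have hG0 : G 0 = 0 := by
    have : x 0 = 0 := by simp only [hx]; rw [hdat]; simp; omega
    simp [hG, this]
  intro t ht
  have hGt : G t = 0 := by
    have h := constant_of_has_deriv_right_zero hGc hGd' t ht
    rw [hG0] at h
    exact h
  have hV : 0 ≤ ∫ u in (0 : ℝ)..t, VISC u :=
    intervalIntegral.integral_nonneg ht.1 fun u _ => mul_nonneg hκ0 (sq_nonneg _)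
  have hE : 0 ≤ (1 / 2 : ℝ) * x t ^ 2 := by positivity
  have key : (∫ u in (0 : ℝ)..t, OUT u) ≤ ∫ u in (0 : ℝ)..t, IN u := by
    simp only [hG] at hGt
    linarith
  simpa only [hOUT, hIN, hx, hxm, hDsum] using key

/-- **Geometric starvation of the chain fluxes** (one step): along an honest non-negative `ν`-viscous solution from a
one-shell datum (`ν ≥ 0`, `ε₀ ≥ 0`, `W ≥ 0`, `W 0 > 0`), for every `m : ℕ` and `t ∈ [0,s]`:
`(1 + r)·Φ_{m+2}(t) ≤ Φ_{m+1}(t)`, `r = (W 1² + W 2² + W 3²)/W 0²`, where `Φ_{k+1}(t) = ∫₀ᵗ Λ_k W₀ x²_{0,k} x_{0,k+1}`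
is the energy carried along the CHAIN through the bond `k → k+1` (the leaks take at least `r` times the onward chain
flux at every instant, by `leakSpray_pocket_ge`). [cite: Tao2016AveragedNS, §4 (4.8)–(4.9), (4.13)] -/
theorem leakSpray_flux_step {ε₀ ν s : ℝ} (hε : 0 ≤ ε₀) (hν : 0 ≤ ν) (hW0 : 0 < W 0) (hWnn : ∀ i, 0 ≤ W i)
    {X₀ : Fin 4 → ℝ} {X : Fin 4 → ℤ → ℝ → ℝ}
    (hdat : ∀ (i : Fin 4) (k : ℤ), X i k 0 = if k = 0 then X₀ i else 0)
    (hXc : ∀ (i : Fin 4) (k : ℤ), Continuous (X i k))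
    (hode : ∀ (i : Fin 4) (k : ℤ), ∀ t ∈ Icc (0 : ℝ) s, HasDerivWithinAt (X i k)
      (quadTerm ε₀ α X i k t - ν * (1 + ε₀) ^ ((2 : ℝ) * k) * X i k t) (Icc (0 : ℝ) s) t)
    (hnn : ∀ t ∈ Icc (0 : ℝ) s, ∀ (i : Fin 4) (k : ℤ), 1 ≤ k → 0 ≤ X i k t) (m : ℕ) :
    ∀ t ∈ Icc (0 : ℝ) s,
      (1 + (W 1 ^ 2 + W 2 ^ 2 + W 3 ^ 2) / W 0 ^ 2) *
          ∫ τ in (0 : ℝ)..t, (1 + ε₀) ^ ((5 : ℝ) * ((m : ℝ) + 1) / 2) *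
            (W 0 * X 0 ((m : ℤ) + 1) τ ^ 2 * X 0 ((m : ℤ) + 2) τ) ≤
        ∫ τ in (0 : ℝ)..t, (1 + ε₀) ^ ((5 : ℝ) * (m : ℝ) / 2) * (W 0 * X 0 (m : ℤ) τ ^ 2 * X 0 ((m : ℤ) + 1) τ) := by
  intro t ht
  have hb : (0 : ℝ) < 1 + ε₀ := by linarith
  have hout := leakSpray_outflux_le_influx hs hc hO hD hW hIn hε hν hdat hXc hode m t ht
  set Λn : ℝ := (1 + ε₀) ^ ((5 : ℝ) * ((m : ℝ) + 1) / 2) with hΛn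
  have hΛn0 : 0 ≤ Λn := by positivity
  -- pointwise: total drain ≥ (1+r)·chain drain
  have hpt : ∀ τ ∈ Icc (0 : ℝ) t,
      (1 + (W 1 ^ 2 + W 2 ^ 2 + W 3 ^ 2) / W 0 ^ 2) * (Λn * (W 0 * X 0 ((m : ℤ) + 1) τ ^ 2 * X 0 ((m : ℤ) + 2) τ)) ≤
        Λn * (X 0 ((m : ℤ) + 1) τ ^ 2 * ∑ j, W j * X j ((m : ℤ) + 2) τ) := by
    intro τ hτ
    have hτs : τ ∈ Icc (0 : ℝ) s := ⟨hτ.1, hτ.2.trans ht.2⟩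
    have hge : ∀ e : Fin 4, e ≠ 0 → W e / W 0 * X 0 ((m : ℤ) + 2) τ ≤ X e ((m : ℤ) + 2) τ := fun e he =>
      leakSpray_pocket_ge hs hc hO hD hW hIn hε hW0 hWnn hdat hode hnn he (by omega) τ hτs
    have h1 := mul_le_mul_of_nonneg_left (hge 1 (by decide)) (hWnn 1)
    have h2 := mul_le_mul_of_nonneg_left (hge 2 (by decide)) (hWnn 2)
    have h3 := mul_le_mul_of_nonneg_left (hge 3 (by decide)) (hWnn 3)
    have hxn : 0 ≤ X 0 ((m : ℤ) + 2) τ := hnn τ hτs 0 _ (by omega)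
    have hsum : (1 + (W 1 ^ 2 + W 2 ^ 2 + W 3 ^ 2) / W 0 ^ 2) * (W 0 * X 0 ((m : ℤ) + 2) τ) ≤
        ∑ j, W j * X j ((m : ℤ) + 2) τ := by
      rw [Fin.sum_univ_four]
      have hid : (1 + (W 1 ^ 2 + W 2 ^ 2 + W 3 ^ 2) / W 0 ^ 2) * (W 0 * X 0 ((m : ℤ) + 2) τ) =
          W 0 * X 0 ((m : ℤ) + 2) τ + W 1 * (W 1 / W 0 * X 0 ((m : ℤ) + 2) τ) +
            W 2 * (W 2 / W 0 * X 0 ((m : ℤ) + 2) τ) + W 3 * (W 3 / W 0 * X 0 ((m : ℤ) + 2) τ) := by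
        field_simp
        ring
      rw [hid]
      have : (0 : Fin 4) = 0 := rfl
      linarith
    have hfac : 0 ≤ Λn * X 0 ((m : ℤ) + 1) τ ^ 2 := by positivity
    have := mul_le_mul_of_nonneg_left hsum hfac
    have hl : (1 + (W 1 ^ 2 + W 2 ^ 2 + W 3 ^ 2) / W 0 ^ 2) * (Λn * (W 0 * X 0 ((m : ℤ) + 1) τ ^ 2 * X 0 ((m : ℤ) + 2) τ)) =
        Λn * X 0 ((m : ℤ) + 1) τ ^ 2 * ((1 + (W 1 ^ 2 + W 2 ^ 2 + W 3 ^ 2) / W 0 ^ 2) * (W 0 * X 0 ((m : ℤ) + 2) τ)) := by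
      ring
    have hr : Λn * (X 0 ((m : ℤ) + 1) τ ^ 2 * ∑ j, W j * X j ((m : ℤ) + 2) τ) =
        Λn * X 0 ((m : ℤ) + 1) τ ^ 2 * ∑ j, W j * X j ((m : ℤ) + 2) τ := by ring
    rw [hl, hr]
    exact this
  have hc1 : Continuous fun τ => Λn * (W 0 * X 0 ((m : ℤ) + 1) τ ^ 2 * X 0 ((m : ℤ) + 2) τ) :=
    continuous_const.mul ((continuous_const.mul ((hXc 0 _).pow 2)).mul (hXc 0 _))
  have hc2 : Continuous fun τ => Λn * (X 0 ((m : ℤ) + 1) τ ^ 2 * ∑ j, W j * X j ((m : ℤ) + 2) τ) :=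
    continuous_const.mul (((hXc 0 _).pow 2).mul (continuous_finsetSum _ fun j _ => continuous_const.mul (hXc j _)))
  have hmono : (1 + (W 1 ^ 2 + W 2 ^ 2 + W 3 ^ 2) / W 0 ^ 2) *
      (∫ τ in (0 : ℝ)..t, Λn * (W 0 * X 0 ((m : ℤ) + 1) τ ^ 2 * X 0 ((m : ℤ) + 2) τ)) ≤
      ∫ τ in (0 : ℝ)..t, Λn * (X 0 ((m : ℤ) + 1) τ ^ 2 * ∑ j, W j * X j ((m : ℤ) + 2) τ) := by
    rw [← intervalIntegral.integral_const_mul]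
    exact intervalIntegral.integral_mono_on ht.1 ((hc1.const_mul _).intervalIntegrable _ _)
      (hc2.intervalIntegrable _ _) hpt
  exact hmono.trans hout

/-- **Geometric starvation of the chain fluxes**: `Φ_{m+1}(t) ≤ E₀·q^m`, `q = (1 + r)⁻¹`, for every bond `m → m+1`
and `t ∈ [0,s]` (induction; base: the chain flux through the bond `0 → 1` is part of the non-negative gate flux,
which is `≤ E₀` by the class-wide budget `kpProper_bondFlux_budget`). [cite: Tao2016AveragedNS, §4 (4.8)–(4.9), (4.13)] -/
theorem leakSpray_flux_le {ε₀ ν s : ℝ} (hε : 0 ≤ ε₀) (hν : 0 ≤ ν) (hW0 : 0 < W 0) (hWnn : ∀ i, 0 ≤ W i)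
    {X₀ : Fin 4 → ℝ} {X : Fin 4 → ℤ → ℝ → ℝ}
    (hdat : ∀ (i : Fin 4) (k : ℤ), X i k 0 = if k = 0 then X₀ i else 0)
    (hvan : ∀ (i : Fin 4) (k : ℤ), k < 0 → ∀ t : ℝ, X i k t = 0)
    (hXc : ∀ (i : Fin 4) (k : ℤ), Continuous (X i k))
    (hode : ∀ (i : Fin 4) (k : ℤ), ∀ t ∈ Icc (0 : ℝ) s, HasDerivWithinAt (X i k)
      (quadTerm ε₀ α X i k t - ν * (1 + ε₀) ^ ((2 : ℝ) * k) * X i k t) (Icc (0 : ℝ) s) t)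
    (hnn : ∀ t ∈ Icc (0 : ℝ) s, ∀ (i : Fin 4) (k : ℤ), 1 ≤ k → 0 ≤ X i k t) :
    ∀ m : ℕ, ∀ t ∈ Icc (0 : ℝ) s,
      ∫ τ in (0 : ℝ)..t, (1 + ε₀) ^ ((5 : ℝ) * (m : ℝ) / 2) * (W 0 * X 0 (m : ℤ) τ ^ 2 * X 0 ((m : ℤ) + 1) τ) ≤
        (∑ i, (1 / 2 : ℝ) * X₀ i ^ 2) * ((1 + (W 1 ^ 2 + W 2 ^ 2 + W 3 ^ 2) / W 0 ^ 2)⁻¹) ^ m := by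
  have hr : 0 < 1 + (W 1 ^ 2 + W 2 ^ 2 + W 3 ^ 2) / W 0 ^ 2 := by positivity
  have hb : (0 : ℝ) < 1 + ε₀ := by linarith
  intro m
  induction m with
  | zero =>
    intro t ht
    have h := kpProper_bondFlux_budget hs hc hO hD hb hν hdat hvan hXc hode 0 t ht
    simp only [leakSpray_gateFlux hW] at h
    -- the chain part of the gate flux is at most the gate flux
    have hc1 : Continuous fun τ => (1 + ε₀) ^ ((5 : ℝ) * ((0 : ℕ) : ℝ) / 2) *
        (W 0 * X 0 ((0 : ℕ) : ℤ) τ ^ 2 * X 0 (((0 : ℕ) : ℤ) + 1) τ) :=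
      continuous_const.mul ((continuous_const.mul ((hXc 0 _).pow 2)).mul (hXc 0 _))
    have hc2 : Continuous fun τ => (1 + ε₀) ^ ((5 : ℝ) * ((0 : ℕ) : ℝ) / 2) *
        (X 0 ((0 : ℕ) : ℤ) τ ^ 2 * ∑ j, W j * X j (((0 : ℕ) : ℤ) + 1) τ) :=
      continuous_const.mul (((hXc 0 _).pow 2).mul (continuous_finsetSum _ fun j _ => continuous_const.mul (hXc j _)))
    have hle : ∫ τ in (0 : ℝ)..t, (1 + ε₀) ^ ((5 : ℝ) * ((0 : ℕ) : ℝ) / 2) *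
          (W 0 * X 0 ((0 : ℕ) : ℤ) τ ^ 2 * X 0 (((0 : ℕ) : ℤ) + 1) τ) ≤
        ∫ τ in (0 : ℝ)..t, (1 + ε₀) ^ ((5 : ℝ) * ((0 : ℕ) : ℝ) / 2) *
          (X 0 ((0 : ℕ) : ℤ) τ ^ 2 * ∑ j, W j * X j (((0 : ℕ) : ℤ) + 1) τ) := by
      refine intervalIntegral.integral_mono_on ht.1 (hc1.intervalIntegrable _ _) (hc2.intervalIntegrable _ _)
        fun τ hτ => ?_
      have hτs : τ ∈ Icc (0 : ℝ) s := ⟨hτ.1, hτ.2.trans ht.2⟩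
      have hΛ : 0 ≤ (1 + ε₀) ^ ((5 : ℝ) * ((0 : ℕ) : ℝ) / 2) := by positivity
      refine mul_le_mul_of_nonneg_left ?_ hΛ
      rw [Fin.sum_univ_four]
      have h1 : 0 ≤ W 1 * X 1 (((0 : ℕ) : ℤ) + 1) τ := mul_nonneg (hWnn 1) (hnn τ hτs 1 _ (by simp))
      have h2 : 0 ≤ W 2 * X 2 (((0 : ℕ) : ℤ) + 1) τ := mul_nonneg (hWnn 2) (hnn τ hτs 2 _ (by simp))
      have h3 : 0 ≤ W 3 * X 3 (((0 : ℕ) : ℤ) + 1) τ := mul_nonneg (hWnn 3) (hnn τ hτs 3 _ (by simp))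
      nlinarith [sq_nonneg (X 0 ((0 : ℕ) : ℤ) τ)]
    rw [pow_zero, mul_one]
    exact hle.trans h
  | succ m ih =>
    intro t ht
    have hstep := leakSpray_flux_step hs hc hO hD hW hIn hε hν hW0 hWnn hdat hXc hode hnn m t ht
    have hih := ih t ht
    have hcast1 : (((m + 1 : ℕ) : ℝ)) = (m : ℝ) + 1 := by push_cast; ring
    have hcast2 : (((m + 1 : ℕ) : ℤ)) = (m : ℤ) + 1 := by push_cast; ring
    have hcast3 : ((m : ℤ) + 1 + 1) = (m : ℤ) + 2 := by ring
    rw [hcast1, hcast2, hcast3, pow_succ]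
    have h2 : ∫ τ in (0 : ℝ)..t, (1 + ε₀) ^ ((5 : ℝ) * ((m : ℝ) + 1) / 2) *
        (W 0 * X 0 ((m : ℤ) + 1) τ ^ 2 * X 0 ((m : ℤ) + 2) τ) ≤
        (∫ τ in (0 : ℝ)..t, (1 + ε₀) ^ ((5 : ℝ) * (m : ℝ) / 2) *
          (W 0 * X 0 (m : ℤ) τ ^ 2 * X 0 ((m : ℤ) + 1) τ)) * (1 + (W 1 ^ 2 + W 2 ^ 2 + W 3 ^ 2) / W 0 ^ 2)⁻¹ := by
      rw [le_mul_inv_iff₀ hr, mul_comm]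
      exact hstep
    calc _ ≤ _ := h2
      _ ≤ (∑ i, (1 / 2 : ℝ) * X₀ i ^ 2) * ((1 + (W 1 ^ 2 + W 2 ^ 2 + W 3 ^ 2) / W 0 ^ 2)⁻¹) ^ m *
            (1 + (W 1 ^ 2 + W 2 ^ 2 + W 3 ^ 2) / W 0 ^ 2)⁻¹ :=
          mul_le_mul_of_nonneg_right hih (inv_nonneg.2 hr.le)
      _ = _ := by ring

end LeakSpray

end Summit.NavierStokesRegularity.NavierStokesRegularity.Theorems

end
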